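import Literature.Analysis.PDE.ParabolicJetsRescaling
import HarnessLib

/-!
# Zooming out a graph: the parabolic `C^{2,α}` norm of `c • u ∘ D_{1/c}`, `0 < c ≤ 1`

Topic `Literature/Geometry/Riemannian` (companion of `FlowC2AlphaNormLSC.lean`, which treats the
blow-DOWN `r • u ∘ D_{1/r}`, `r ≥ 1`).  The dilation `D_c 𝓜` of a set contained in the parabolic
graph of `u` over `B^{m,1}(1/c)` is contained in the graph of `v = c • u ∘ D_{1/c}` over the unit
ball, and the jets of `v` are those of `u` rescaled: `D v = D u ∘ D_{1/c}`,
`D² v = c⁻¹ D² u ∘ D_{1/c}`, `∂ₜ v = c⁻¹ ∂ₜ u ∘ D_{1/c}`, parabolic distances scaling by `c⁻¹`.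
Hence (`c2αNormOn_zoomOut_le`)

  `‖c • u ∘ D_{1/c}‖_{2,α; B^{m,1}} ≤ 8 c⁻² K`   whenever   `‖u‖_{2,α; B^{m,1}(1/c)} ≤ K`.

This is the scaling used at the end of the proof of White's Thm. 3.1 (2005, p. 1499): if the graph
functions `uᵢ` of the normalized flows tend to `0` in `C^{2,α}` on `B(0, 2)`, then `D_{1/2} 𝓜ᵢ` has
a unit graph bound, i.e. `K_{2,α}(𝓜ᵢ, 0) ≤ 1/2`, contradicting the normalization
`K_{2,α}(𝓜ᵢ, 0) = 1`.

Everything is PROVED; no definitions, no named facts.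

## References

* B. White, *A local regularity theorem for mean curvature flow*, Ann. of Math. 161 (2005), §2.5
  and p. 1499. [White2005]
-/

noncomputable section

namespace Literature.Geometry.Riemannian

open Literature.Analysis.PDE Literature.Analysis.PDE.Parabolic Metric Set Filter Topology
open scoped ENNReal NNReal

namespace ParabolicFlow

variable {E F : Type*} [NormedAddCommGroup E] [NormedSpace ℝ E] [NormedAddCommGroup F]
  [NormedSpace ℝ F] {α : ℝ≥0} {u : Parabolic E → F} {c : ℝ}

/-- `D_{1/c}` maps the unit ball onto the ball of radius `1/c`. [cite: White2005, §2.1] -/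
theorem dilation_inv_mem_ball_inv (hc : 0 < c) {X : Parabolic E}
    (hX : X ∈ ball (0 : Parabolic E) 1) :
    dilation c⁻¹ X ∈ ball (0 : Parabolic E) c⁻¹ := by
  have h := image_dilation_ball (inv_pos.2 hc) (0 : Parabolic E) 1
  rw [dilation_zero', mul_one] at h
  rw [← h]
  exact mem_image_of_mem _ hX

omit [NormedAddCommGroup F] [NormedSpace ℝ F] in
/-- The zoomed-out function as an affine rescaling. [folklore] -/
theorem zoomOut_eq (c : ℝ) (u : Parabolic E → F) :
    (u ∘ dilation c⁻¹) = fun Z' => u (0 + dilation c⁻¹ Z') := by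
  funext Z; simp

/-- Jets of the zoom-out on the unit ball: `D`, `D²`, `∂ₜ` and the guard. [folklore] -/
theorem jets_zoomOut (hc : 0 < c) (hC : IsC21On u (ball 0 c⁻¹)) :
    IsC21On (c • (u ∘ dilation c⁻¹)) (ball (0 : Parabolic E) 1) ∧
    (∀ X ∈ ball (0 : Parabolic E) 1,
      spaceDeriv (c • (u ∘ dilation c⁻¹)) X = spaceDeriv u (dilation c⁻¹ X)) ∧
    (∀ X ∈ ball (0 : Parabolic E) 1,
      spaceDeriv (spaceDeriv (c • (u ∘ dilation c⁻¹))) X =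
        c⁻¹ • spaceDeriv (spaceDeriv u) (dilation c⁻¹ X)) ∧
    (∀ X ∈ ball (0 : Parabolic E) 1,
      timeDeriv (c • (u ∘ dilation c⁻¹)) X = c⁻¹ • timeDeriv u (dilation c⁻¹ X)) := by
  have hc0 : c ≠ 0 := hc.ne'
  have hopen : IsOpen (ball (0 : Parabolic E) c⁻¹) := isOpen_ball
  have hmem : ∀ X ∈ ball (0 : Parabolic E) 1, (0 : Parabolic E) + dilation c⁻¹ X ∈ ball 0 c⁻¹ :=
    fun X hX => by rw [zero_add]; exact dilation_inv_mem_ball_inv hc hX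
  have hguard : IsC21On (u ∘ dilation c⁻¹) (ball (0 : Parabolic E) 1) := by
    rw [zoomOut_eq]
    exact (hC.comp_affine_of_isOpen hopen 0 c⁻¹).mono fun X hX => hmem X hX
  refine ⟨isC21On_const_smul hguard c, fun X hX => ?_, fun X hX => ?_, fun X hX => ?_⟩
  · rw [spaceDeriv_const_smul, Pi.smul_apply, zoomOut_eq,
      spaceDeriv_comp_affine_of_mem hC 0 c⁻¹ (hmem X hX), zero_add, smul_smul,
      mul_inv_cancel₀ hc0, one_smul]
  · rw [spaceDeriv_const_smul, spaceDeriv_const_smul, Pi.smul_apply, zoomOut_eq,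
      spaceDeriv_spaceDeriv_comp_affine_of_mem hC hopen 0 c⁻¹ (hmem X hX), zero_add, smul_smul]
    congr 1
    field_simp
  · rw [timeDeriv_const_smul, Pi.smul_apply, zoomOut_eq,
      timeDeriv_comp_affine_of_mem hC 0 c⁻¹ (hmem X hX), zero_add, smul_smul]
    congr 1
    field_simp

/-- For `0 < c ≤ 1` and `a ≤ 2`: `c⁻ᵃ ≤ c⁻²`. [folklore] -/
theorem inv_rpow_le_inv_sq (hc : 0 < c) (hc1 : c ≤ 1) {a : ℝ} (ha2 : a ≤ 2) :
    c⁻¹ ^ a ≤ c⁻¹ ^ 2 := by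
  have h1 : (1 : ℝ) ≤ c⁻¹ := one_le_inv_iff₀.2 ⟨hc, hc1⟩
  calc c⁻¹ ^ a ≤ c⁻¹ ^ (2 : ℝ) := Real.rpow_le_rpow_of_exponent_le h1 ha2
    _ = c⁻¹ ^ 2 := by rw [Real.rpow_two]

/-- **Zooming out costs at most `c⁻²`**: if `‖u‖_{2,α; B(1/c)} ≤ K` and `0 < c ≤ 1`, `α ≤ 1`, then
`‖c • u ∘ D_{1/c}‖_{2,α; B(1)} ≤ 8 c⁻² K`. [cite: White2005, §2.5, p. 1499] -/
theorem c2αNormOn_zoomOut_le (hα1 : α ≤ 1) (hc : 0 < c) (hc1 : c ≤ 1) {K : ℝ≥0}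
    (hn : c2αNormOn α u (ball 0 c⁻¹) ≤ K) :
    c2αNormOn α (c • (u ∘ dilation c⁻¹)) (ball (0 : Parabolic E) 1) ≤
      ENNReal.ofReal (8 * c⁻¹ ^ 2 * K) := by
  have hC : IsC21On u (ball 0 c⁻¹) :=
    isC21On_of_c2αNormOn_ne_top (ne_top_of_le_ne_top ENNReal.coe_ne_top hn)
  obtain ⟨hCv, hD, hD2, hT⟩ := jets_zoomOut hc hC
  set v : Parabolic E → F := c • (u ∘ dilation c⁻¹) with hv
  -- component bounds of `u` on `B(1/c)`
  have h0 : holderNormOn α u (ball 0 c⁻¹) ≤ K := (holderNormOn_le_c2αNormOn α u _).trans hn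
  have h1 : holderNormOn α (spaceDeriv u) (ball 0 c⁻¹) ≤ K :=
    (holderNormOn_spaceDeriv_le_c2αNormOn α u _).trans hn
  have h2 : holderNormOn α (spaceDeriv (spaceDeriv u)) (ball 0 c⁻¹) ≤ K :=
    (holderNormOn_spaceDeriv_spaceDeriv_le_c2αNormOn α u _).trans hn
  have h3 : holderNormOn α (timeDeriv u) (ball 0 c⁻¹) ≤ K :=
    (holderNormOn_timeDeriv_le_c2αNormOn α u _).trans hn
  -- scaling constants
  have hci : (1 : ℝ) ≤ c⁻¹ := one_le_inv_iff₀.2 ⟨hc, hc1⟩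
  have hK : (0 : ℝ) ≤ K := K.2
  have hc2K : (K : ℝ) ≤ c⁻¹ ^ 2 * K := le_mul_of_one_le_left hK (one_le_pow₀ hci)
  have hcα : c⁻¹ ^ (α : ℝ) ≤ c⁻¹ ^ 2 := inv_rpow_le_inv_sq hc hc1 (by
    have : (α : ℝ) ≤ 1 := hα1
    linarith)
  have hc1α : c⁻¹ * c⁻¹ ^ (α : ℝ) ≤ c⁻¹ ^ 2 := by
    have h : c⁻¹ * c⁻¹ ^ (α : ℝ) = c⁻¹ ^ ((α : ℝ) + 1) := by
      rw [Real.rpow_add_one (inv_ne_zero hc.ne'), mul_comm]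
    rw [h]
    exact inv_rpow_le_inv_sq hc hc1 (by
      have : (α : ℝ) ≤ 1 := hα1
      linarith)
  -- distances scale by `c⁻¹`
  have hdist : ∀ X Y : Parabolic E, dist (dilation c⁻¹ X) (dilation c⁻¹ Y) = c⁻¹ * dist X Y :=
    fun X Y => dist_dilation (inv_nonneg.2 hc.le) X Y
  have hdistα : ∀ X Y : Parabolic E,
      dist (dilation c⁻¹ X) (dilation c⁻¹ Y) ^ (α : ℝ) = c⁻¹ ^ (α : ℝ) * dist X Y ^ (α : ℝ) :=
    fun X Y => by rw [hdist, Real.mul_rpow (inv_nonneg.2 hc.le) dist_nonneg]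
  set K' : ℝ≥0 := ⟨c⁻¹ ^ 2 * K, by positivity⟩ with hK'
  have hK'c : ((K' : ℝ≥0) : ℝ) = c⁻¹ ^ 2 * K := rfl
  have hmemB : ∀ X ∈ ball (0 : Parabolic E) 1, dilation c⁻¹ X ∈ ball (0 : Parabolic E) c⁻¹ :=
    fun X hX => dilation_inv_mem_ball_inv hc hX
  -- the four component bounds of `v`
  have b0 : holderNormOn α v (ball 0 1) ≤ K' + K' := by
    refine holderNormOn_le_of_bounds (fun X hX => ?_) (fun X hX Y hY => ?_)
    · have h := norm_le_of_holderNormOn_le h0 (hmemB X hX)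
      simp only [hv, Pi.smul_apply, Function.comp_apply, norm_smul, Real.norm_eq_abs,
        abs_of_pos hc, hK'c]
      calc c * ‖u (dilation c⁻¹ X)‖ ≤ 1 * K := mul_le_mul hc1 h (norm_nonneg _) zero_le_one
        _ ≤ c⁻¹ ^ 2 * K := by rw [one_mul]; exact hc2K
    · have h := norm_sub_le_of_holderNormOn_le h0 (hmemB X hX) (hmemB Y hY)
      rw [hdistα] at h
      simp only [hv, Pi.smul_apply, Function.comp_apply, ← smul_sub, norm_smul, Real.norm_eq_abs,
        abs_of_pos hc, hK'c]
      have hd : 0 ≤ dist X Y ^ (α : ℝ) := by positivity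
      calc c * ‖u (dilation c⁻¹ X) - u (dilation c⁻¹ Y)‖
          ≤ 1 * (K * (c⁻¹ ^ (α : ℝ) * dist X Y ^ (α : ℝ))) :=
            mul_le_mul hc1 h (norm_nonneg _) zero_le_one
        _ = (c⁻¹ ^ (α : ℝ) * K) * dist X Y ^ (α : ℝ) := by ring
        _ ≤ (c⁻¹ ^ 2 * K) * dist X Y ^ (α : ℝ) :=
            mul_le_mul_of_nonneg_right (mul_le_mul_of_nonneg_right hcα hK) hd
  have b1 : holderNormOn α (spaceDeriv v) (ball 0 1) ≤ K' + K' := by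
    refine holderNormOn_le_of_bounds (fun X hX => ?_) (fun X hX Y hY => ?_)
    · rw [hD X hX, hK'c]
      exact (norm_le_of_holderNormOn_le h1 (hmemB X hX)).trans hc2K
    · rw [hD X hX, hD Y hY, hK'c]
      have h := norm_sub_le_of_holderNormOn_le h1 (hmemB X hX) (hmemB Y hY)
      rw [hdistα] at h
      have hd : 0 ≤ dist X Y ^ (α : ℝ) := by positivity
      calc ‖spaceDeriv u (dilation c⁻¹ X) - spaceDeriv u (dilation c⁻¹ Y)‖
          ≤ (c⁻¹ ^ (α : ℝ) * K) * dist X Y ^ (α : ℝ) := by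
            rw [mul_comm (c⁻¹ ^ (α:ℝ)) (K:ℝ)]; linarith
        _ ≤ (c⁻¹ ^ 2 * K) * dist X Y ^ (α : ℝ) :=
            mul_le_mul_of_nonneg_right (mul_le_mul_of_nonneg_right hcα hK) hd
  have b2 : holderNormOn α (spaceDeriv (spaceDeriv v)) (ball 0 1) ≤ K' + K' := by
    refine holderNormOn_le_of_bounds (fun X hX => ?_) (fun X hX Y hY => ?_)
    · rw [hD2 X hX, norm_smul, Real.norm_eq_abs, abs_of_pos (inv_pos.2 hc), hK'c]
      have h := norm_le_of_holderNormOn_le h2 (hmemB X hX)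
      calc c⁻¹ * ‖spaceDeriv (spaceDeriv u) (dilation c⁻¹ X)‖ ≤ c⁻¹ * K :=
            mul_le_mul_of_nonneg_left h (inv_nonneg.2 hc.le)
        _ ≤ c⁻¹ ^ 2 * K := mul_le_mul_of_nonneg_right (by nlinarith) hK
    · rw [hD2 X hX, hD2 Y hY, ← smul_sub, norm_smul, Real.norm_eq_abs, abs_of_pos (inv_pos.2 hc),
        hK'c]
      have h := norm_sub_le_of_holderNormOn_le h2 (hmemB X hX) (hmemB Y hY)
      rw [hdistα] at h
      have hd : 0 ≤ dist X Y ^ (α : ℝ) := by positivity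
      calc c⁻¹ * ‖spaceDeriv (spaceDeriv u) (dilation c⁻¹ X) -
            spaceDeriv (spaceDeriv u) (dilation c⁻¹ Y)‖
          ≤ c⁻¹ * (K * (c⁻¹ ^ (α : ℝ) * dist X Y ^ (α : ℝ))) :=
            mul_le_mul_of_nonneg_left h (inv_nonneg.2 hc.le)
        _ = (c⁻¹ * c⁻¹ ^ (α : ℝ)) * K * dist X Y ^ (α : ℝ) := by ring
        _ ≤ c⁻¹ ^ 2 * K * dist X Y ^ (α : ℝ) :=
            mul_le_mul_of_nonneg_right (mul_le_mul_of_nonneg_right hc1α hK) hd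
  have b3 : holderNormOn α (timeDeriv v) (ball 0 1) ≤ K' + K' := by
    refine holderNormOn_le_of_bounds (fun X hX => ?_) (fun X hX Y hY => ?_)
    · rw [hT X hX, norm_smul, Real.norm_eq_abs, abs_of_pos (inv_pos.2 hc), hK'c]
      have h := norm_le_of_holderNormOn_le h3 (hmemB X hX)
      calc c⁻¹ * ‖timeDeriv u (dilation c⁻¹ X)‖ ≤ c⁻¹ * K :=
            mul_le_mul_of_nonneg_left h (inv_nonneg.2 hc.le)
        _ ≤ c⁻¹ ^ 2 * K := mul_le_mul_of_nonneg_right (by nlinarith) hK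
    · rw [hT X hX, hT Y hY, ← smul_sub, norm_smul, Real.norm_eq_abs, abs_of_pos (inv_pos.2 hc),
        hK'c]
      have h := norm_sub_le_of_holderNormOn_le h3 (hmemB X hX) (hmemB Y hY)
      rw [hdistα] at h
      have hd : 0 ≤ dist X Y ^ (α : ℝ) := by positivity
      calc c⁻¹ * ‖timeDeriv u (dilation c⁻¹ X) - timeDeriv u (dilation c⁻¹ Y)‖
          ≤ c⁻¹ * (K * (c⁻¹ ^ (α : ℝ) * dist X Y ^ (α : ℝ))) :=
            mul_le_mul_of_nonneg_left h (inv_nonneg.2 hc.le)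
        _ = (c⁻¹ * c⁻¹ ^ (α : ℝ)) * K * dist X Y ^ (α : ℝ) := by ring
        _ ≤ c⁻¹ ^ 2 * K * dist X Y ^ (α : ℝ) :=
            mul_le_mul_of_nonneg_right (mul_le_mul_of_nonneg_right hc1α hK) hd
  -- assemble
  rw [c2αNormOn_eq hCv]
  calc holderNormOn α v (ball 0 1) + holderNormOn α (spaceDeriv v) (ball 0 1) +
        holderNormOn α (spaceDeriv (spaceDeriv v)) (ball 0 1) +
        holderNormOn α (timeDeriv v) (ball 0 1)
      ≤ ((K' + K' : ℝ≥0) : ℝ≥0∞) + (K' + K' : ℝ≥0) + (K' + K' : ℝ≥0) + (K' + K' : ℝ≥0) :=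
        add_le_add (add_le_add (add_le_add b0 b1) b2) b3
    _ = ENNReal.ofReal (8 * c⁻¹ ^ 2 * K) := by
        rw [← ENNReal.coe_add, ← ENNReal.coe_add, ← ENNReal.coe_add, ← ENNReal.ofReal_coe_nnreal]
        congr 1
        push_cast
        rw [hK'c]; ring

/-! ### Zooming out a graph over a plane, and the `K_{2,α}` bound -/

section Graph

open scoped InnerProductSpace

variable {N m : ℕ}

/-- **Zooming out a graph**: if `S ∩ B^{N,1}(1/c)` lies on the graph of `u` over `L`, then
`D_c S ∩ B^{N,1}` lies on the graph of `c • u ∘ D_{1/c}` over `L` (`0 < c`).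
[cite: White2005, §2.5] -/
theorem subset_parabolicGraph_zoomOut
    {L : EuclideanSpace ℝ (Fin m) →ₗᵢ[ℝ] EuclideanSpace ℝ (Fin N)}
    {u : Parabolic (EuclideanSpace ℝ (Fin m)) → EuclideanSpace ℝ (Fin N)}
    (hu : ∀ X η, ⟪u X, L η⟫_ℝ = 0) {c : ℝ} (hc : 0 < c)
    {S : Set (Parabolic (EuclideanSpace ℝ (Fin N)))}
    (hsub : S ∩ ball 0 c⁻¹ ⊆ parabolicGraph L u (ball 0 c⁻¹)) :
    dilation c '' S ∩ ball 0 1 ⊆ parabolicGraph L (c • (u ∘ dilation c⁻¹)) (ball 0 1) := by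
  have hc0 : c ≠ 0 := hc.ne'
  rintro Y ⟨⟨Y₀, hY₀S, rfl⟩, hYB⟩
  have hY₀ : Y₀ = dilation c⁻¹ (dilation c Y₀) := by
    rw [dilation_dilation, inv_mul_cancel₀ hc0, dilation_one]
  have hY₀B : Y₀ ∈ ball (0 : Parabolic (EuclideanSpace ℝ (Fin N))) c⁻¹ := by
    rw [hY₀]; exact dilation_inv_mem_ball_inv hc hYB
  obtain ⟨Ξ, hΞB, hΞ⟩ := mem_parabolicGraph.1 (hsub ⟨hY₀S, hY₀B⟩)
  have hx : L Ξ.x + u Ξ = Y₀.x := congrArg Parabolic.x hΞ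
  have ht : Ξ.t = Y₀.t := congrArg Parabolic.t hΞ
  have hYx : (dilation c Y₀).x = L (c • Ξ.x) + c • u Ξ := by
    rw [dilation_x, L.map_smul, ← smul_add, hx]
  have hYt : (dilation c Y₀).t = c ^ 2 * Ξ.t := by rw [dilation_t, ht]
  obtain ⟨hYx1, hYt1⟩ := (mem_ball_zero_one_iff (dilation c Y₀)).1 hYB
  refine mem_parabolicGraph.2 ⟨dilation c Ξ, ?_, ?_⟩
  · rw [mem_ball_zero_one_iff, dilation_x, dilation_t]
    constructor
    · calc ‖c • Ξ.x‖ ≤ ‖L (c • Ξ.x) + c • u Ξ‖ :=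
            norm_le_norm_map_add_of_inner_eq_zero
              (fun η => by rw [real_inner_smul_left, hu, mul_zero]) _
        _ = ‖(dilation c Y₀).x‖ := by rw [hYx]
        _ < 1 := hYx1
    · rw [← hYt]; exact hYt1
  · have h1 : (c • (u ∘ dilation c⁻¹)) (dilation c Ξ) = c • u Ξ := by
      simp only [Pi.smul_apply, Function.comp_apply, dilation_dilation, inv_mul_cancel₀ hc0,
        dilation_one]
    rw [h1]
    ext1
    · rw [hYx, dilation_x]
    · rw [hYt, dilation_t]

/-- **A small graph norm on `B(1/c)` makes `D_c` a good dilation**: if `S ∩ B^{N,1}(1/c)` lies on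
the
graph of `u ⊥ range L` with `‖u‖_{2,α; B(1/c)} ≤ K` and `8 c⁻² K ≤ 1` (`0 < c ≤ 1`, `α ≤ 1`), then
`D_c S` has a unit graph bound; in particular `K_{2,α}(S, 0) ≤ c` (`k2α_le`).  For `c = 1/2` this is
the contradiction with the normalization `K_{2,α}(𝓜ᵢ, 0) = 1` at the end of the proof of White's
Thm. 3.1. [cite: White2005, §2.5, p. 1499] -/
theorem hasUnitGraphBound_dilation_of_norm_le {α : ℝ≥0} (hα1 : α ≤ 1)
    {L : EuclideanSpace ℝ (Fin m) →ₗᵢ[ℝ] EuclideanSpace ℝ (Fin N)}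
    {u : Parabolic (EuclideanSpace ℝ (Fin m)) → EuclideanSpace ℝ (Fin N)}
    (hu : ∀ X η, ⟪u X, L η⟫_ℝ = 0) {c : ℝ} (hc : 0 < c) (hc1 : c ≤ 1)
    {S : Set (Parabolic (EuclideanSpace ℝ (Fin N)))}
    (hsub : S ∩ ball 0 c⁻¹ ⊆ parabolicGraph L u (ball 0 c⁻¹)) {K : ℝ≥0}
    (hn : c2αNormOn α u (ball 0 c⁻¹) ≤ K) (hK : 8 * c⁻¹ ^ 2 * K ≤ 1) :
    HasUnitGraphBound m α (dilation c '' S) := by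
  refine ⟨L, c • (u ∘ dilation c⁻¹), fun X η => ?_, ?_, subset_parabolicGraph_zoomOut hu hc hsub⟩
  · simp only [Pi.smul_apply, Function.comp_apply, real_inner_smul_left, hu, mul_zero]
  · calc c2αNormOn α (c • (u ∘ dilation c⁻¹)) (ball 0 1) ≤ ENNReal.ofReal (8 * c⁻¹ ^ 2 * K) :=
          c2αNormOn_zoomOut_le hα1 hc hc1 hn
      _ ≤ ENNReal.ofReal 1 := ENNReal.ofReal_le_ofReal hK
      _ = 1 := ENNReal.ofReal_one

/-- Hence `K_{2,α}(S, 0) ≤ c`. [cite: White2005, §2.5, p. 1499] -/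
theorem k2α_zero_le_of_norm_le {α : ℝ≥0} (hα1 : α ≤ 1)
    {L : EuclideanSpace ℝ (Fin m) →ₗᵢ[ℝ] EuclideanSpace ℝ (Fin N)}
    {u : Parabolic (EuclideanSpace ℝ (Fin m)) → EuclideanSpace ℝ (Fin N)}
    (hu : ∀ X η, ⟪u X, L η⟫_ℝ = 0) {c : ℝ} (hc : 0 < c) (hc1 : c ≤ 1)
    {S : Set (Parabolic (EuclideanSpace ℝ (Fin N)))}
    (hsub : S ∩ ball 0 c⁻¹ ⊆ parabolicGraph L u (ball 0 c⁻¹)) {K : ℝ≥0}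
    (hn : c2αNormOn α u (ball 0 c⁻¹) ≤ K) (hK : 8 * c⁻¹ ^ 2 * K ≤ 1) :
    k2α m α S 0 ≤ ENNReal.ofReal c := by
  refine k2α_le hc ?_
  have hS : ((· - (0 : Parabolic (EuclideanSpace ℝ (Fin N)))) '' S) = S := by simp
  rw [hS]
  exact hasUnitGraphBound_dilation_of_norm_le hα1 hu hc hc1 hsub hn hK

end Graph

end ParabolicFlow

end Literature.Geometry.Riemannian
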